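import Literature.AlgebraicGeometry.ShimuraVarieties.UnitaryAuxiliaryTorusDatum
import Literature.AlgebraicGeometry.ShimuraVarieties.UnitaryShimuraCanonicalModelArtin
import HarnessLib

/-!
# Every `σ ∈ Aut(ℂ/E♯)` has an Artin-correspondent finite idèle of the reflex field `E♯`
# ([Milne 2005] (59) p. 107: «for any `s ∈ 𝔸_E^×` with `art_E(s) = σ|E^{ab}`» — non-vacuity over the reflex field
# `E♯ = τ(L)·E*(Φ)` of the auxiliary datum)

Topic `AlgebraicGeometry/ShimuraVarieties`; namespace `Literature.AlgebraicGeometry.ShimuraVarieties.UnitaryCanonicalModel.Aux`.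
THEOREMS ONLY.  The tree's `exists_finiteIdele_isArtinCorrespondent` is stated for a CM field; here the same two halves
(`exists_absoluteGaloisGroup_restrict`, no hypothesis on the field; `exists_finiteIdele_absGaloisAbProj_eq_theta_inv`,
totally complex fields) are run for the reflex field `E♯ = Aux.reflexField L Φ τ ⊂ ℂ`, which is TOTALLY COMPLEX because
it contains `τ(L)` with `L` CM (Mathlib `isTotallyComplex_of_algebra` along `Aux.toReflexField`).  This is VERBATIM the
support stub (a′) `StubArtinSurjectiveReflex` of the hodgecm-mathlib B-I skeleton `B1HeckeQuotientDescent` v7 (:665),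
consumed by `galoisLegDescentOver_general_of` (the idèle passage of stub (A) in general degree).  Cell hodgecm-mathlib
(D-0151); HC_CM is proved only modulo the 7 printed citations until rung 0 closes; nothing here touches them.

References: [Milne2005ShimuraVarieties] p. 107 L9–15 and (59); [Deligne1979ShimuraVarieties] 0.8, 2.2.3.
-/

set_option autoImplicit false

noncomputable section

open NumberField IsDedekindDomain
open Literature.AlgebraicGeometry.Motives (CMType)
open Literature.NumberTheory.GaloisRepresentations

namespace Literature.AlgebraicGeometry.ShimuraVarieties

namespace UnitaryCanonicalModel

namespace Aux

variable (L : Type) [Field L] [NumberField L] [IsCMField L]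

/-- **The reflex field `E♯ ⊇ τ(L)` is totally complex** (a real place of `E♯` would restrict to a real place of the CM
field `L`; Mathlib `isTotallyComplex_of_algebra`). [cite: Liu2021, App. C Lem. C.14 (p. 113)] -/
theorem isTotallyComplex_reflexField (Φ : CMType L) (τ : L →+* ℂ) : IsTotallyComplex ↥(reflexField L Φ τ) := by
  letI : Algebra L ↥(reflexField L Φ τ) := (toReflexField L Φ τ).toAlgebra
  exact isTotallyComplex_of_algebra L ↥(reflexField L Φ τ)

/-- **Every `σ ∈ Aut(ℂ)` fixing `E♯` pointwise has an Artin-correspondent finite idèle of `E♯`**: `∃ s ∈ 𝔸_{E♯,f}^×`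
with `art_{E♯}(s) = σ|_{E♯^{ab}}` in the sense of the tree's `IsArtinCorrespondent` (Galois half:
`exists_absoluteGaloisGroup_restrict`; idèle half: `exists_finiteIdele_absGaloisAbProj_eq_theta_inv`, `E♯` totally
complex). [cite: Milne2005ShimuraVarieties, p. 107 L9–15 and (59); Def. 12.8 (62) p. 114]
[cite: Deligne1979ShimuraVarieties, 0.8 and 2.2.3] -/
theorem exists_finiteIdele_isArtinCorrespondent_reflexField (Φ : CMType L) (τ : L →+* ℂ) (σ : ℂ ≃+* ℂ)
    (hσ : ∀ x : ↥(reflexField L Φ τ), σ (algebraMap ↥(reflexField L Φ τ) ℂ x) = algebraMap ↥(reflexField L Φ τ) ℂ x) :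
    haveI : NumberField ↥(reflexField L Φ τ) := numberField_reflexField L Φ τ
    ∃ s : (FiniteAdeleRing (𝓞 ↥(reflexField L Φ τ)) ↥(reflexField L Φ τ))ˣ,
      UnitaryCanonicalModel.IsArtinCorrespondent ↥(reflexField L Φ τ) (algebraMap ↥(reflexField L Φ τ) ℂ) s σ := by
  haveI : NumberField ↥(reflexField L Φ τ) := numberField_reflexField L Φ τ
  haveI : IsTotallyComplex ↥(reflexField L Φ τ) := isTotallyComplex_reflexField L Φ τ
  obtain ⟨e, γ, he⟩ := exists_absoluteGaloisGroup_restrict ↥(reflexField L Φ τ) (algebraMap ↥(reflexField L Φ τ) ℂ) σ hσ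
  obtain ⟨s, hs⟩ := exists_finiteIdele_absGaloisAbProj_eq_theta_inv γ
  exact ⟨s, e, γ, he, hs⟩

/-- **Packaged** in the binder order of the B-I skeleton's support stub (a′) `StubArtinSurjectiveReflex`
(B1HeckeQuotientDescent v7 :665), so that `hA := Aux.artinSurjectiveReflex` closes it.
[cite: Milne2005ShimuraVarieties, p. 107 L9–15 and (59)] -/
theorem artinSurjectiveReflex :
    ∀ (L : Type) [Field L] [NumberField L] [IsCMField L] (Φ : CMType L) (τ : L →+* ℂ),
      (haveI : NumberField ↥(reflexField L Φ τ) := numberField_reflexField L Φ τ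
       ∀ σ : ℂ ≃+* ℂ, (∀ x : ↥(reflexField L Φ τ), σ (algebraMap ↥(reflexField L Φ τ) ℂ x) =
          algebraMap ↥(reflexField L Φ τ) ℂ x) →
         ∃ s : (FiniteAdeleRing (𝓞 ↥(reflexField L Φ τ)) ↥(reflexField L Φ τ))ˣ,
           UnitaryCanonicalModel.IsArtinCorrespondent ↥(reflexField L Φ τ)
             (algebraMap ↥(reflexField L Φ τ) ℂ) s σ) :=
  fun L _ _ _ Φ τ σ hσ => exists_finiteIdele_isArtinCorrespondent_reflexField L Φ τ σ hσ

end Aux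

end UnitaryCanonicalModel

end Literature.AlgebraicGeometry.ShimuraVarieties

end
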